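import Summits.ResolutionOfSingularities.ResolutionOfSingularities.Theorems.HilbertSamuelEliminationSigmaMaxModificationsCorridor3WLadderIsoKernelPerfect
import Summits.ResolutionOfSingularities.ResolutionOfSingularities.Theorems.HilbertSamuelEliminationSigmaMaxModificationsCorridor3WLadderIsoTailsFreeRationalArcLimit
import HarnessLib

/-!
# [OURS · L1 W4.2] THE ISO-KERNEL AT ALGEBRAICALLY CLOSED / PERFECT ORIGINS, WITH K1 A THEOREM: it is K3-sep (resp. K2-sep ∧ K3-sep) ALONE

Crux chain w42 (`SigmaMaxModifications`, stmt-ResolutionOfSingularities-18506; conjunct `SigmaMaxModificationsCorridor3`, stmt-…-19249),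
line `w_ladder`, registered stub `stub_isoSepRecurrent` (K2-sep ∧ K3-sep) / `stub_isoInsepTower` of skeleton v8.6. Lead res-L1-w42-lead-1
(gen 5). Helper file `--supports stmt-ResolutionOfSingularities-19249`; kernel only (no definition, no named fact).

WHAT IS PROVED. `IdeasL1C5.false_of_isIsoPointTower_of_isAlgClosed` / `_of_perfectField` (p545326) with their K1 hypothesis DISCHARGED by
res-L1-w42-stub-2's theorem `IsoTailsHS.isoFreeRationalTailsImpossible_holds` (p546901, every embedding dimension): at an origin with
ALGEBRAICALLY CLOSED residue field an isolated E3 point tower is impossible as soon as K3-sep holds (`false_of_isIsoPointTower_of_isAlgClosed_of_K3sep`,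
ground-field form `…_over_isAlgClosed_of_K3sep`); at a PERFECT origin as soon as K2-sep ∧ K3-sep hold (`…_of_perfectField_of_sepRecurrent`,
`…_over_perfectField_of_sepRecurrent`) — i.e. the registered row `stub_isoSepRecurrent` ALONE closes the kernel over perfect ground fields, and
its K3-sep half alone over algebraically closed ones ((k2) `stub_isoInsepTower` is not needed there).

HONEST FRAMING. OURS bookkeeping; nothing here is a statement of H. Hironaka's manuscript [Hironaka2017] nor of [CossartJannsenSaito2020] /
[CossartPiltant2009]. AI-written; AI review is weaker than expert review.
-/

noncomputable section

set_option linter.dupNamespace false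

open CategoryTheory AlgebraicGeometry TopologicalSpace IsLocalRing
open Summit.ResolutionOfSingularities.ResolutionOfSingularities.Theorems.CampaignW42
open Summit.ResolutionOfSingularities.ResolutionOfSingularities.Theorems.SigmaMaxModificationsCorridor3
open Literature.AlgebraicGeometry.Resolution Literature.AlgebraicGeometry.CossartJannsenSaito2020
open Summit.ResolutionOfSingularities.ResolutionOfSingularities.Cruxes.SigmaMaxModifications.IdeasL1Idea2R4
  (IsIsoPointTower IsoQuadraticTowerTerminates)

namespace Summit.ResolutionOfSingularities.ResolutionOfSingularities.Cruxes.SigmaMaxModifications.IdeasL1C5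

universe u

variable {p N : ℕ} {ν : ℕ → ℕ} {T : BlowupTower.{u}} {pt : ∀ n, T.X n}

/-- **THE KERNEL AT AN ALGEBRAICALLY CLOSED ORIGIN IS K3-sep** (K1 being a theorem, p546901): an isolated E3 point tower over a maximal
origin at level `3` with algebraically closed residue field is impossible as soon as satellite-recurrence is (on eventually separable towers).
[cite: CossartPiltant2009, ch. 4 II.4] [cite: CossartJannsenSaito2020, Def. 6.38] -/
theorem false_of_isIsoPointTower_of_isAlgClosed_of_K3sep (h3 : IsoSepSatelliteRecurrentImpossible.{u} p 3)
    (hO : IsMaximalOrigin p 3 ν (T.X 0) (pt 0)) (hT : IsIsoPointTower 3 ν T pt)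
    (h0 : IsAlgClosed (ResidueField ((T.X 0).presheaf.stalk (pt 0)))) : False :=
  false_of_isIsoPointTower_of_isAlgClosed (IsoTailsHS.isoFreeRationalTailsImpossible_holds p) h3 hO hT h0

/-- … ground-field form: origin stage locally of finite type over an ALGEBRAICALLY CLOSED field. [cite: CossartPiltant2009, ch. 4 II.4] -/
theorem false_of_isIsoPointTower_over_isAlgClosed_of_K3sep (h3 : IsoSepSatelliteRecurrentImpossible.{u} p 3)
    {k : Type u} [Field k] [IsAlgClosed k] (f : T.X 0 ⟶ Spec (.of k)) [LocallyOfFiniteType f]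
    (hO : IsMaximalOrigin p 3 ν (T.X 0) (pt 0)) (hT : IsIsoPointTower 3 ν T pt) : False :=
  false_of_isIsoPointTower_over_isAlgClosed (IsoTailsHS.isoFreeRationalTailsImpossible_holds p) h3 f hO hT

/-- **THE KERNEL AT A PERFECT ORIGIN IS K2-sep ∧ K3-sep** (= the registered row `stub_isoSepRecurrent` at that prime; (k2) not needed, K1 a
theorem). [cite: CossartPiltant2009, ch. 3 I.8.3 (ix), ch. 4 II.4] [cite: CossartJannsenSaito2020, Def. 6.38] -/
theorem false_of_isIsoPointTower_of_perfectField_of_sepRecurrent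
    (h23 : IsoSepJumpRecurrentImpossible.{u} p 3 ∧ IsoSepSatelliteRecurrentImpossible.{u} p 3)
    (hO : IsMaximalOrigin p 3 ν (T.X 0) (pt 0)) (hT : IsIsoPointTower 3 ν T pt)
    (h0 : PerfectField (ResidueField ((T.X 0).presheaf.stalk (pt 0)))) : False :=
  false_of_isIsoPointTower_of_perfectField (IsoTailsHS.isoFreeRationalTailsImpossible_holds p) h23.1 h23.2 hO hT h0

/-- … ground-field form: origin stage locally of finite type over a PERFECT field (finite fields, `𝔽̄_p`, …).
[cite: CossartPiltant2009, ch. 3 I.8.3 (ix), ch. 4 II.4] -/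
theorem false_of_isIsoPointTower_over_perfectField_of_sepRecurrent
    (h23 : IsoSepJumpRecurrentImpossible.{u} p 3 ∧ IsoSepSatelliteRecurrentImpossible.{u} p 3)
    {k : Type u} [Field k] [PerfectField k] (f : T.X 0 ⟶ Spec (.of k)) [LocallyOfFiniteType f]
    (hO : IsMaximalOrigin p 3 ν (T.X 0) (pt 0)) (hT : IsIsoPointTower 3 ν T pt) : False :=
  false_of_isIsoPointTower_over_perfectField (IsoTailsHS.isoFreeRationalTailsImpossible_holds p) h23.1 h23.2 f hO hT

end Summit.ResolutionOfSingularities.ResolutionOfSingularities.Cruxes.SigmaMaxModifications.IdeasL1C5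

end
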